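import Mathlib.Analysis.Calculus.ContDiff.Bounds
import Literature.Geometry.Lorentzian.AsymptoticFlatnessProofs
import HarnessLib

/-!
# Smooth symbols at infinity: the `O_k(r^a)` calculus of asymptotically flat ends

The decay classes of the asymptotic-flatness prelude (`AFEnd.IsStronglyAsymptoticallyFlatWith`,
`IsAsymptoticallySchwarzschild`, Bartnik's `IsMetricAsymptoticallyFlat`) are all of the shape
"`‖∂^m f(x)‖ = O(‖x‖^{a-m})` for `m ≤ k` as `‖x‖ → ∞`", with Mathlib's `iteratedFDeriv ℝ m`
along `Bornology.cobounded`, for functions on the chart `E3` of an end (Schoen–Yau, Comm. Math.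
Phys. 65 (1979), (1.1): `hᵢⱼ = O(r⁻²)`, `∂hᵢⱼ = O(r⁻³)`, `∂∂hᵢⱼ = O(r⁻⁴)`; Bartnik, CPAM 39
(1986), Def. 2.1). This file sets up the elementary calculus of such **smooth symbols**
(`IsBigOSmooth k a f`: `f` is `C^∞` on a far region `{R₀ < ‖y‖}` and obeys the bounds above),
which every "the new metric is again asymptotically flat, with mass …" step of the literature
uses silently:

* closure under sums, constants, scalar and constant multiples, negation, differences
  (`IsBigOSmooth.add`, `isBigOSmooth_const`, …);
* the **Leibniz rule** `O_k(r^a) · O_k(r^b) ⊆ O_k(r^{a+b})` (`IsBigOSmooth.smul`, `.mul`, from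
  Mathlib's `norm_iteratedFDerivWithin_smul_le` on the open far region), powers of `O_k(1)`
  symbols and the binomial step `(s + t)⁴ - s⁴ ∈ O_k(r^a)` for `s ∈ O_k(1)`, `t ∈ O_k(r^a)`;
* locality (`congr_far`: symbols ignore modifications on bounded sets — the chart components of
  the prelude carry junk values inside the ball);
* `1/r ∈ O₂(r⁻¹)` on a real inner product space (`isBigOSmooth_inv_norm`, from the derivative
  formulas of `AsymptoticFlatnessProofs.lean`), hence `c + A/r ∈ O₂(1)`;
* as the application for which it was written, the chart computation behind the mass of a
  conformally changed metric `φ⁴ ds²` (`isBigOSmooth_conformalFourth_chart`; Schoen–Yau 1979,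
  §2, Step 1, p. 49): `ψ = 1 + A/r + O₂(r⁻²)` and `H = (1 + M/2r)⁴ c + O₂(r⁻²)` give
  `ψ⁴ H = (1 + (M+2A)/2r)⁴ c + O₂(r⁻²)`.

Smoothness is part of the class on purpose: Mathlib's `iteratedFDeriv` is junk-valued (`0`)
where a function is not differentiable, so that no Leibniz or sum rule holds for the bare decay
bounds (cf. the module docstring of `AsymptoticFlatnessProofs.lean`, which treats one such sum
junk-robustly); users supply smoothness of chart components through the prelude fact
`AFEnd.ContDiffOn_hCoeff`.

## References

* R. Schoen, S.-T. Yau, *On the proof of the positive mass conjecture in general relativity*,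
  Comm. Math. Phys. 65 (1979) 45–76, §1 (1.1) and §2, Step 1 (p. 49).
* R. Bartnik, *The mass of an asymptotically flat manifold*, CPAM 39 (1986), Def. 2.1.
-/

noncomputable section

open Set Filter Asymptotics Bornology Topology
open scoped ContDiff

namespace Literature.Geometry.Lorentzian

section Symbol

variable {E : Type*} [NormedAddCommGroup E] {W : Type*} [NormedAddCommGroup W] [NormedSpace ℝ W]

/-- The numeral bound `(m : ℕ∞ω) ≤ ∞` (finite orders are below `C^∞`). [folklore] -/
theorem natCast_le_infty (m : ℕ) : (m : ℕ∞ω) ≤ ∞ := by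
  exact_mod_cast le_top

/-- The far regions `{R₀ < ‖y‖}` are open. [folklore] -/
theorem isOpen_setOf_lt_norm (R₀ : ℝ) : IsOpen {y : E | R₀ < ‖y‖} :=
  isOpen_lt continuous_const continuous_norm

/-- The far regions decrease with the radius. [folklore] -/
theorem setOf_lt_norm_anti {R₀ R₁ : ℝ} (h : R₀ ≤ R₁) :
    {y : E | R₁ < ‖y‖} ⊆ {y : E | R₀ < ‖y‖} :=
  fun _ hy ↦ lt_of_le_of_lt h hy

/-- Every far region `{R₀ < ‖y‖}` is eventually entered along `cobounded`. [folklore] -/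
theorem eventually_cobounded_lt_norm (R₀ : ℝ) : ∀ᶠ y in cobounded E, R₀ < ‖y‖ := by
  filter_upwards [eventually_cobounded_le_norm (E := E) (R₀ + 1)] with y hy
  linarith

/-- Slower power decay dominates faster power decay at infinity, on any real normed space:
`‖x‖ ^ p = O(‖x‖ ^ q)` along `cobounded` for `p ≤ q`. [folklore] -/
theorem isBigO_norm_rpow_rpow_cobounded {p q : ℝ} (h : p ≤ q) :
    (fun x : E ↦ ‖x‖ ^ p) =O[cobounded E] fun x ↦ ‖x‖ ^ q := by
  refine IsBigO.of_bound 1 ?_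
  filter_upwards [eventually_cobounded_le_norm (E := E) 1] with x hx
  rw [one_mul, Real.norm_of_nonneg (Real.rpow_nonneg (norm_nonneg _) _),
    Real.norm_of_nonneg (Real.rpow_nonneg (norm_nonneg _) _)]
  exact Real.rpow_le_rpow_of_exponent_le hx h

/-- Products of powers of `‖x‖` merge at infinity: `‖x‖ ^ p ‖x‖ ^ q = ‖x‖ ^ (p + q)` for
`‖x‖ ≥ 1`. [folklore] -/
theorem norm_rpow_mul_rpow_eventuallyEq (p q : ℝ) :
    (fun x : E ↦ ‖x‖ ^ p * ‖x‖ ^ q) =ᶠ[cobounded E] fun x ↦ ‖x‖ ^ (p + q) := by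
  filter_upwards [eventually_cobounded_le_norm (E := E) 1] with x hx
  rw [← Real.rpow_add (by linarith)]

variable [NormedSpace ℝ E]

/-- **Smooth symbols of order `a` at infinity** (the bookkeeping class of the `O_k(r^a)` calculus
of asymptotically flat ends, e.g. Schoen–Yau 1979, (1.1): "`hᵢⱼ = O(r⁻²)`, `∂hᵢⱼ = O(r⁻³)`,
`∂∂hᵢⱼ = O(r⁻⁴)`"): `f : E → W` is `C^∞` on some far region `{R₀ < ‖y‖}` and
`‖∂^m f(x)‖ = O(‖x‖^{a-m})` as `‖x‖ → ∞` for every `m ≤ k` (`iteratedFDeriv ℝ m` along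
`Bornology.cobounded E`). [cite: SchoenYauPMT1979, §1 (1.1)] -/
def IsBigOSmooth (k : ℕ) (a : ℝ) (f : E → W) : Prop :=
  (∃ R₀ : ℝ, ContDiffOn ℝ ∞ f {y : E | R₀ < ‖y‖}) ∧
    ∀ m : ℕ, m ≤ k →
      (fun x ↦ ‖iteratedFDeriv ℝ m f x‖) =O[cobounded E] fun x ↦ ‖x‖ ^ (a - m)

namespace IsBigOSmooth

variable {k : ℕ} {a b : ℝ} {f g : E → W}

/-- The decay bound of a smooth symbol at order `m ≤ k`. [folklore] -/
theorem isBigO (hf : IsBigOSmooth k a f) {m : ℕ} (hm : m ≤ k) :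
    (fun x ↦ ‖iteratedFDeriv ℝ m f x‖) =O[cobounded E] fun x ↦ ‖x‖ ^ (a - m) :=
  hf.2 m hm

/-- A smooth symbol is smooth at every point of some far region. [folklore] -/
theorem eventually_contDiffAt (hf : IsBigOSmooth k a f) :
    ∃ R₀ : ℝ, ∀ y : E, R₀ < ‖y‖ → ContDiffAt ℝ ∞ f y := by
  obtain ⟨R₀, hR₀⟩ := hf.1
  exact ⟨R₀, fun y hy ↦ hR₀.contDiffAt ((isOpen_setOf_lt_norm R₀).mem_nhds hy)⟩

/-- Symbols of order `a` are symbols of every order `b ≥ a`. [folklore] -/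
theorem mono (hf : IsBigOSmooth k a f) (hab : a ≤ b) : IsBigOSmooth k b f :=
  ⟨hf.1, fun m hm ↦ (hf.2 m hm).trans (isBigO_norm_rpow_rpow_cobounded (by linarith))⟩

/-- Fewer derivatives: a `k`-symbol is a `k'`-symbol for `k' ≤ k`. [folklore] -/
theorem of_le (hf : IsBigOSmooth k a f) {k' : ℕ} (hk : k' ≤ k) : IsBigOSmooth k' a f :=
  ⟨hf.1, fun m hm ↦ hf.2 m (hm.trans hk)⟩

/-- Symbols are insensitive to modification on a bounded set: if `g = f` on a far region then
`g` is a symbol of the same order (derivatives are local). [folklore] -/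
theorem congr_far (hf : IsBigOSmooth k a f) {R₁ : ℝ} (hfg : ∀ y : E, R₁ < ‖y‖ → f y = g y) :
    IsBigOSmooth k a g := by
  obtain ⟨⟨R₀, hR₀⟩, hO⟩ := hf
  refine ⟨⟨max R₀ R₁, ?_⟩, fun m hm ↦ ?_⟩
  · refine (hR₀.mono (setOf_lt_norm_anti (le_max_left _ _))).congr fun y hy ↦ ?_
    exact (hfg y (setOf_lt_norm_anti (le_max_right R₀ R₁) hy)).symm
  · refine (hO m hm).congr' ?_ EventuallyEq.rfl
    filter_upwards [eventually_cobounded_lt_norm (E := E) R₁] with y hy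
    have hloc : f =ᶠ[𝓝 y] g := by
      filter_upwards [(isOpen_setOf_lt_norm R₁).mem_nhds hy] with z hz
      exact hfg z hz
    rw [(hloc.iteratedFDeriv ℝ m).eq_of_nhds]

/-- Pointwise-equal functions are symbols together. [folklore] -/
theorem congr (hf : IsBigOSmooth k a f) (hfg : ∀ y : E, f y = g y) : IsBigOSmooth k a g :=
  hf.congr_far (R₁ := 0) fun y _ ↦ hfg y

/-- **Sum rule.** [folklore] -/
theorem add (hf : IsBigOSmooth k a f) (hg : IsBigOSmooth k a g) :
    IsBigOSmooth k a fun y ↦ f y + g y := by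
  obtain ⟨R₁, hR₁⟩ := hf.eventually_contDiffAt
  obtain ⟨R₂, hR₂⟩ := hg.eventually_contDiffAt
  refine ⟨?_, fun m hm ↦ ?_⟩
  · obtain ⟨S₁, hS₁⟩ := hf.1
    obtain ⟨S₂, hS₂⟩ := hg.1
    exact ⟨max S₁ S₂, (hS₁.mono (setOf_lt_norm_anti (le_max_left _ _))).add
      (hS₂.mono (setOf_lt_norm_anti (le_max_right _ _)))⟩
  · have H : ∀ᶠ x in cobounded E, ‖iteratedFDeriv ℝ m (fun y ↦ f y + g y) x‖ ≤
        ‖iteratedFDeriv ℝ m f x‖ + ‖iteratedFDeriv ℝ m g x‖ := by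
      filter_upwards [eventually_cobounded_lt_norm (E := E) (max R₁ R₂)] with x hx
      have hfx := (hR₁ x (lt_of_le_of_lt (le_max_left _ _) hx)).of_le (natCast_le_infty m)
      have hgx := (hR₂ x (lt_of_le_of_lt (le_max_right _ _) hx)).of_le (natCast_le_infty m)
      rw [show (fun y ↦ f y + g y) = f + g from rfl, iteratedFDeriv_add_apply hfx hgx]
      exact norm_add_le _ _
    exact (IsBigO.of_norm_eventuallyLE
      (H.mono fun x hx ↦ (Real.norm_of_nonneg (norm_nonneg _)).trans_le hx)).trans
      ((hf.isBigO hm).add (hg.isBigO hm))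

end IsBigOSmooth

/-- **Constants are symbols of order `0`.** [folklore] -/
theorem isBigOSmooth_const (k : ℕ) (c : W) : IsBigOSmooth k 0 fun _ : E ↦ c := by
  refine ⟨⟨0, contDiffOn_const⟩, fun m _ ↦ ?_⟩
  rcases Nat.eq_zero_or_pos m with rfl | hm
  · simp only [norm_iteratedFDeriv_zero, Nat.cast_zero, sub_zero, Real.rpow_zero]
    exact isBigO_const_const _ one_ne_zero _
  · have h0 : (fun x : E ↦ ‖iteratedFDeriv ℝ m (fun _ : E ↦ c) x‖) = fun _ ↦ 0 := by
      funext x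
      rw [iteratedFDeriv_const_of_ne hm.ne' c, Pi.zero_apply, norm_zero]
    rw [h0]
    exact isBigO_zero _ _

namespace IsBigOSmooth

variable {k : ℕ} {a b : ℝ}

/-- **Product rule (Leibniz).** A scalar symbol of order `a` times a vector symbol of order `b`
is a symbol of order `a + b`: `∂^m (f g) = Σ (m choose i) ∂^i f ∂^{m-i} g` and
`r^{a-i} r^{b-(m-i)} = r^{a+b-m}` (Mathlib's `norm_iteratedFDerivWithin_smul_le` on the open far
region). [folklore] -/
theorem smul {f : E → ℝ} {g : E → W} (hf : IsBigOSmooth k a f) (hg : IsBigOSmooth k b g) :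
    IsBigOSmooth k (a + b) fun y ↦ f y • g y := by
  obtain ⟨⟨R₁, hR₁⟩, hfO⟩ := hf
  obtain ⟨⟨R₂, hR₂⟩, hgO⟩ := hg
  set s : Set E := {y | max R₁ R₂ < ‖y‖} with hs_def
  have hs : IsOpen s := isOpen_setOf_lt_norm _
  have hfs : ContDiffOn ℝ ∞ f s := hR₁.mono (setOf_lt_norm_anti (le_max_left _ _))
  have hgs : ContDiffOn ℝ ∞ g s := hR₂.mono (setOf_lt_norm_anti (le_max_right _ _))
  refine ⟨⟨max R₁ R₂, hfs.smul hgs⟩, fun m hm ↦ ?_⟩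
  -- the Leibniz bound on the far region
  have key : ∀ y ∈ s, ‖iteratedFDeriv ℝ m (fun y ↦ f y • g y) y‖ ≤
      ∑ i ∈ Finset.range (m + 1), (m.choose i : ℝ) * ‖iteratedFDeriv ℝ i f y‖ *
        ‖iteratedFDeriv ℝ (m - i) g y‖ := by
    intro y hy
    calc ‖iteratedFDeriv ℝ m (fun y ↦ f y • g y) y‖
        = ‖iteratedFDerivWithin ℝ m (fun y ↦ f y • g y) s y‖ := by
          rw [iteratedFDerivWithin_of_isOpen m hs hy]
      _ ≤ ∑ i ∈ Finset.range (m + 1), (m.choose i : ℝ) * ‖iteratedFDerivWithin ℝ i f s y‖ *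
            ‖iteratedFDerivWithin ℝ (m - i) g s y‖ :=
          norm_iteratedFDerivWithin_smul_le hfs hgs hs.uniqueDiffOn hy (natCast_le_infty m)
      _ = _ := by
          refine Finset.sum_congr rfl fun i _ ↦ ?_
          rw [iteratedFDerivWithin_of_isOpen i hs hy, iteratedFDerivWithin_of_isOpen (m - i) hs hy]
  -- each Leibniz term is `O(r^{a+b-m})`
  have hterm : ∀ i ∈ Finset.range (m + 1),
      (fun y ↦ (m.choose i : ℝ) * ‖iteratedFDeriv ℝ i f y‖ * ‖iteratedFDeriv ℝ (m - i) g y‖)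
        =O[cobounded E] fun x ↦ ‖x‖ ^ (a + b - m) := by
    intro i hi
    have him : i ≤ m := Nat.lt_succ_iff.1 (Finset.mem_range.1 hi)
    have h1 := (hfO i (him.trans hm)).const_mul_left (m.choose i : ℝ)
    have h2 := hgO (m - i) ((Nat.sub_le m i).trans hm)
    refine (h1.mul h2).trans (EventuallyEq.isBigO ?_)
    refine (norm_rpow_mul_rpow_eventuallyEq (E := E) (a - i) (b - (m - i : ℕ))).trans ?_
    refine Eventually.of_forall fun x ↦ ?_
    rw [Nat.cast_sub him]
    ring_nf
  have hsum := IsBigO.sum hterm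
  have H : ∀ᶠ y in cobounded E, ‖iteratedFDeriv ℝ m (fun y ↦ f y • g y) y‖ ≤
      ∑ i ∈ Finset.range (m + 1), (m.choose i : ℝ) * ‖iteratedFDeriv ℝ i f y‖ *
        ‖iteratedFDeriv ℝ (m - i) g y‖ := by
    filter_upwards [eventually_cobounded_lt_norm (E := E) (max R₁ R₂)] with y hy
    exact key y hy
  exact (IsBigO.of_norm_eventuallyLE
    (H.mono fun x hx ↦ (Real.norm_of_nonneg (norm_nonneg _)).trans_le hx)).trans hsum

/-- Product rule for scalar symbols. [folklore] -/
theorem mul {f g : E → ℝ} (hf : IsBigOSmooth k a f) (hg : IsBigOSmooth k b g) :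
    IsBigOSmooth k (a + b) fun y ↦ f y * g y :=
  hf.smul hg

/-- Constant multiples of symbols. [folklore] -/
theorem const_smul {f : E → W} (hf : IsBigOSmooth k a f) (c : ℝ) :
    IsBigOSmooth k a fun y ↦ c • f y := by
  simpa only [zero_add] using (isBigOSmooth_const k c).smul hf

/-- Constant multiples of scalar symbols. [folklore] -/
theorem const_mul {f : E → ℝ} (hf : IsBigOSmooth k a f) (c : ℝ) :
    IsBigOSmooth k a fun y ↦ c * f y :=
  hf.const_smul c

/-- Negatives of symbols. [folklore] -/
theorem neg {f : E → W} (hf : IsBigOSmooth k a f) : IsBigOSmooth k a fun y ↦ -f y :=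
  (hf.const_smul (-1)).congr fun y ↦ by simp

/-- Differences of symbols. [folklore] -/
theorem sub {f g : E → W} (hf : IsBigOSmooth k a f) (hg : IsBigOSmooth k a g) :
    IsBigOSmooth k a fun y ↦ f y - g y :=
  (hf.add hg.neg).congr fun y ↦ by simp [sub_eq_add_neg]

/-- A scalar symbol times a constant vector. [folklore] -/
theorem smul_const {f : E → ℝ} (hf : IsBigOSmooth k a f) (c : W) :
    IsBigOSmooth k a fun y ↦ f y • c := by
  simpa only [add_zero] using hf.smul (isBigOSmooth_const k c)

/-- Products of symbols of order `0`. [folklore] -/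
theorem mul₀ {f g : E → ℝ} (hf : IsBigOSmooth k 0 f) (hg : IsBigOSmooth k 0 g) :
    IsBigOSmooth k 0 fun y ↦ f y * g y := by
  simpa only [add_zero] using hf.mul hg

/-- Powers of symbols of order `0`. [folklore] -/
theorem pow {f : E → ℝ} (hf : IsBigOSmooth k 0 f) (n : ℕ) :
    IsBigOSmooth k 0 fun y ↦ f y ^ n := by
  induction n with
  | zero => simpa only [pow_zero] using isBigOSmooth_const (E := E) k (1 : ℝ)
  | succ n ih => simpa only [pow_succ, add_zero] using ih.mul hf

/-- **`(s + t)⁴ - s⁴` has the order of `t`** for `s = O_k(1)` and `t = O_k(r^a)`, `a ≤ 0`: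
`(s + t)⁴ - s⁴ = t (4s³ + 6s²t + 4st² + t³)` (the binomial step of the mass read-off for
`φ⁴ ds²`, Schoen–Yau 1979, p. 49). [folklore] -/
theorem add_pow_four_sub_pow_four {s t : E → ℝ} (hs : IsBigOSmooth k 0 s)
    (ht : IsBigOSmooth k a t) (ha : a ≤ 0) :
    IsBigOSmooth k a fun y ↦ (s y + t y) ^ 4 - s y ^ 4 := by
  have ht0 : IsBigOSmooth k 0 t := ht.mono ha
  have hP : IsBigOSmooth k 0 fun y ↦
      4 * s y ^ 3 + 6 * (s y ^ 2 * t y) + 4 * (s y * t y ^ 2) + t y ^ 3 :=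
    ((((hs.pow 3).const_mul 4).add (((hs.pow 2).mul₀ ht0).const_mul 6)).add
      ((hs.mul₀ (ht0.pow 2)).const_mul 4)).add (ht0.pow 3)
  have h := ht.mul hP
  simp only [add_zero] at h
  exact h.congr fun y ↦ by ring

end IsBigOSmooth

section InvNorm

variable {E : Type*} [NormedAddCommGroup E] [InnerProductSpace ℝ E]

/-- **`1/r` is a symbol of order `-1`** (to second order): `‖·‖⁻¹` is smooth away from the
origin with `‖D(1/r)‖ = r⁻²`, `‖D²(1/r)‖ ≤ 4r⁻³` (`norm_fderiv_inv_norm`,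
`norm_fderiv_fderiv_inv_norm_le`). [folklore] -/
theorem isBigOSmooth_inv_norm : IsBigOSmooth 2 (-1) fun y : E ↦ ‖y‖⁻¹ := by
  refine ⟨⟨0, fun y hy ↦ ?_⟩, fun m hm ↦ ?_⟩
  · have hy0 : y ≠ 0 := norm_pos_iff.1 hy
    exact ((contDiffAt_norm ℝ hy0).inv (norm_ne_zero_iff.2 hy0)).contDiffWithinAt
  have hne : ∀ᶠ x in cobounded E, x ≠ 0 := by
    filter_upwards [eventually_cobounded_lt_norm (E := E) 0] with x hx
    exact norm_pos_iff.1 hx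
  have e0 : ∀ x : E, ‖x‖ ^ (-1 - ((0 : ℕ) : ℝ)) = ‖x‖⁻¹ := fun x ↦ by
    rw [Nat.cast_zero, sub_zero, Real.rpow_neg_one]
  have e1 : ∀ x : E, ‖x‖ ^ (-1 - ((1 : ℕ) : ℝ)) = (‖x‖ ^ 2)⁻¹ := fun x ↦ by
    rw [← Real.rpow_natCast, ← Real.rpow_neg (norm_nonneg x)]
    norm_num
  have e2 : ∀ x : E, ‖x‖ ^ (-1 - ((2 : ℕ) : ℝ)) = (‖x‖ ^ 3)⁻¹ := fun x ↦ by
    rw [← Real.rpow_natCast, ← Real.rpow_neg (norm_nonneg x)]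
    norm_num
  interval_cases m
  · have h0 : (fun x : E ↦ ‖iteratedFDeriv ℝ 0 (fun y : E ↦ ‖y‖⁻¹) x‖) =
        fun x ↦ ‖x‖ ^ (-1 - ((0 : ℕ) : ℝ)) := by
      funext x
      rw [norm_iteratedFDeriv_zero, norm_inv, norm_norm, e0]
    rw [h0]
  · refine (isBigO_refl (fun x : E ↦ ‖x‖ ^ (-1 - ((1 : ℕ) : ℝ))) _).congr' ?_ EventuallyEq.rfl
    filter_upwards [hne] with x hx
    rw [norm_iteratedFDeriv_one, norm_fderiv_inv_norm hx, e1]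
  · refine (IsBigO.of_bound 4 ?_).congr_right fun x ↦ (e2 x).symm
    filter_upwards [hne] with x hx
    rw [Real.norm_of_nonneg (norm_nonneg _), Real.norm_of_nonneg (by positivity),
      ← norm_iteratedFDeriv_fderiv, norm_iteratedFDeriv_one]
    exact norm_fderiv_fderiv_inv_norm_le hx

/-- `c + A/r` is a symbol of order `0` (to second order). [folklore] -/
theorem isBigOSmooth_const_add_mul_inv_norm (c A : ℝ) :
    IsBigOSmooth 2 0 fun y : E ↦ c + A * ‖y‖⁻¹ :=
  (isBigOSmooth_const 2 c).add
    ((isBigOSmooth_inv_norm.mono (by norm_num)).const_mul A)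

end InvNorm

end Symbol

/-! ### Application: the chart computation behind the mass of `φ⁴ ds²` -/

section Chart

/-- **The chart computation behind the mass of `φ⁴ ds²`.** On `E3`, let `H` (valued in any real
normed space, e.g. the chart components of a metric) and `ψ` (real) be smooth on a far region
`{R < ‖y‖}`, with `H = (1 + M/2r)⁴ c + O₂(r⁻²)` and `ψ = 1 + A/r + O₂(r⁻²)` (junk-free: the
functions are smooth where it matters). Then `ψ⁴ H = (1 + (M + 2A)/2r)⁴ c + O₂(r⁻²)`, as a
smooth symbol of order `-2`: writing `u = 1 + M/2r`, `ũ = 1 + (M+2A)/2r`, `ψ = 1 + A/r + ε`,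
one has `ψu - ũ = AM/(2r²) + εu =: η = O₂(r⁻²)` and
`ψ⁴ H - ũ⁴ c = ψ⁴ (H - u⁴ c) + ((ũ + η)⁴ - ũ⁴) c`. This is the computation "on `N_k` we have
`d̃s² = φ⁴ ds² = …`; thus the new mass of `N_k` is `M̃ = …`" of Schoen–Yau 1979, §2, Step 1
(p. 49). [cite: SchoenYauPMT1979, §2 Step 1 (p. 49)] -/
theorem isBigOSmooth_conformalFourth_chart {W : Type*} [NormedAddCommGroup W] [NormedSpace ℝ W]
    {H : E3 → W} {ψ : E3 → ℝ} (c : W) {M A R : ℝ}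
    (hH : ContDiffOn ℝ ∞ H {y | R < ‖y‖}) (hψ : ContDiffOn ℝ ∞ ψ {y | R < ‖y‖})
    (hG : ∀ m : ℕ, m ≤ 2 →
      (fun x ↦ ‖iteratedFDeriv ℝ m (fun y ↦ H y - (1 + M / (2 * ‖y‖)) ^ 4 • c) x‖)
        =O[cobounded E3] fun x ↦ ‖x‖ ^ (-2 - m : ℝ))
    (hε : ∀ m : ℕ, m ≤ 2 →
      (fun x ↦ ‖iteratedFDeriv ℝ m (fun y ↦ ψ y - (1 + A / ‖y‖)) x‖)
        =O[cobounded E3] fun x ↦ ‖x‖ ^ (-2 - m : ℝ)) :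
    IsBigOSmooth 2 (-2) fun y ↦ ψ y ^ 4 • H y - (1 + (M + 2 * A) / (2 * ‖y‖)) ^ 4 • c := by
  -- the model functions `u`, `ũ`, `w`
  have hu : IsBigOSmooth 2 0 fun y : E3 ↦ 1 + M / (2 * ‖y‖) :=
    (isBigOSmooth_const_add_mul_inv_norm 1 (M / 2)).congr fun y ↦ by ring
  have hut : IsBigOSmooth 2 0 fun y : E3 ↦ 1 + (M + 2 * A) / (2 * ‖y‖) :=
    (isBigOSmooth_const_add_mul_inv_norm 1 ((M + 2 * A) / 2)).congr fun y ↦ by ring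
  have hw : IsBigOSmooth 2 0 fun y : E3 ↦ 1 + A / ‖y‖ :=
    (isBigOSmooth_const_add_mul_inv_norm 1 A).congr fun y ↦ by ring
  -- the two decaying inputs `ε = ψ - w` and `G = H - u⁴ c`
  obtain ⟨R₀, hR₀⟩ := hw.1
  have hεs : IsBigOSmooth 2 (-2) fun y ↦ ψ y - (1 + A / ‖y‖) :=
    ⟨⟨max R R₀, (hψ.mono (setOf_lt_norm_anti (le_max_left _ _))).sub
      (hR₀.mono (setOf_lt_norm_anti (le_max_right _ _)))⟩, hε⟩
  obtain ⟨R₁, hR₁⟩ := ((hu.pow 4).smul_const c).1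
  have hGs : IsBigOSmooth 2 (-2) fun y ↦ H y - (1 + M / (2 * ‖y‖)) ^ 4 • c :=
    ⟨⟨max R R₁, (hH.mono (setOf_lt_norm_anti (le_max_left _ _))).sub
      (hR₁.mono (setOf_lt_norm_anti (le_max_right _ _)))⟩, hG⟩
  -- `ψ = w + ε = O₂(1)`
  have hψs : IsBigOSmooth 2 0 ψ :=
    ((hεs.mono (by norm_num)).add hw).congr fun y ↦ by ring
  -- `η = ψ u - ũ = ε u + AM/(2r²) = O₂(r⁻²)`
  have hη : IsBigOSmooth 2 (-2) fun y ↦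
      ψ y * (1 + M / (2 * ‖y‖)) - (1 + (M + 2 * A) / (2 * ‖y‖)) := by
    have h1 : IsBigOSmooth 2 (-2) fun y ↦ (ψ y - (1 + A / ‖y‖)) * (1 + M / (2 * ‖y‖)) := by
      simpa only [add_zero] using hεs.mul hu
    have h2 : IsBigOSmooth 2 (-2) fun y : E3 ↦ A * M / 2 * (‖y‖⁻¹ * ‖y‖⁻¹) := by
      have h := (isBigOSmooth_inv_norm (E := E3)).mul isBigOSmooth_inv_norm
      norm_num at h
      exact h.const_mul _
    exact (h1.add h2).congr fun y ↦ by ring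
  -- `ψ⁴ u⁴ - ũ⁴ = (ũ + η)⁴ - ũ⁴ = O₂(r⁻²)`
  have hdiff : IsBigOSmooth 2 (-2) fun y ↦
      ψ y ^ 4 * (1 + M / (2 * ‖y‖)) ^ 4 - (1 + (M + 2 * A) / (2 * ‖y‖)) ^ 4 :=
    (hut.add_pow_four_sub_pow_four hη (by norm_num)).congr fun y ↦ by ring
  -- `ψ⁴ H - ũ⁴ c = ψ⁴ G + (ψ⁴ u⁴ - ũ⁴) c`
  have hA : IsBigOSmooth 2 (-2) fun y ↦ ψ y ^ 4 • (H y - (1 + M / (2 * ‖y‖)) ^ 4 • c) := by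
    simpa only [zero_add] using (hψs.pow 4).smul hGs
  exact (hA.add (hdiff.smul_const c)).congr fun y ↦ by
    rw [smul_sub, smul_smul, sub_smul]
    abel

end Chart

end Literature.Geometry.Lorentzian

end
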